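import Mathlib
import Literature.Computability.Complexity.CookBridges
import Literature.Computability.Complexity.ProbabilisticClassesProofs
import Summits.PneNP.PneNP.Theses.WitnessForging

/-!
# Route WitnessForging — support item `ClassBridge` (stmt-PneNP-10555)

`Summit.PneNP.PneNP.Theses.WitnessForging.ClassBridge`: if every Cook-NP language over `{0,1}`
is Cook-P (`PNPWave0.NP Bool ⊆ PNPWave0.P Bool`, the classes of the summit statement `PneNP`)
then `Nondeterministic.NP ⊆ BPP` in the prelude model the route's machinery lives in. This is
the third hypothesis of the route's deciding theorem `closes`.

Proof, from PROVED facts of the tree only, through the conjecture-free bridge module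
`CookBridges.lean` (so the import cone of this file does not contain the open conjecture
`NPNotSubsetPPoly` registered in `ClayProblem.lean`):
* `CookBridges.np_bool_eq : PNPWave0.NP Bool = Nondeterministic.NP` (Arora–Barak 2009, Def. 2.1;
  robustness of the model, Claims 1.5–1.6);
* `p_bool_eq : PNPWave0.P Bool = Classes.P` (Cook, Clay problem description §1; Arora–Barak
  2009, Def. 1.13);
* `P_subset_BPP_holds : Classes.P ⊆ BPP` (Gill 1977, Prop. 5.1; Arora–Barak 2009, §7.1).
Rewrite the hypothesis along the two equalities to `Nondeterministic.NP ⊆ Classes.P`, then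
compose with `Classes.P ⊆ BPP`.
-/

namespace Summit.PneNP.PneNP.Theorems

open Literature.Computability.Complexity

/-- **Support item `ClassBridge` of route WitnessForging** (stmt-PneNP-10555): the model bridge
`PNPWave0.NP Bool ⊆ PNPWave0.P Bool → Nondeterministic.NP ⊆ BPP`, by the two class equalities
`CookBridges.np_bool_eq`, `p_bool_eq` and `P ⊆ BPP` (`P_subset_BPP_holds`).
[cite: CookClay2006, §1] [cite: AroraBarakCC2009, Def. 1.13, Def. 2.1, §7.1]
[cite: Gill1977, Prop. 5.1] -/
theorem classBridge_proof : Summit.PneNP.PneNP.Theses.WitnessForging.ClassBridge := by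
  unfold Summit.PneNP.PneNP.Theses.WitnessForging.ClassBridge
  intro hsub
  rw [CookBridges.np_bool_eq, p_bool_eq] at hsub
  exact fun L hL => P_subset_BPP_holds (hsub hL)

end Summit.PneNP.PneNP.Theorems
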